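import Literature.NumberTheory.EllipticCurves.TwoDescent
import Literature.NumberTheory.EllipticCurves.MordellWeilTheoremProofs
import Mathlib.FieldTheory.Galois.Basic
import Mathlib.RingTheory.Finiteness.Nakayama
import Mathlib.LinearAlgebra.Dimension.Torsion.Finite
import HarnessLib

/-!
# The rank is unchanged in an odd-degree Galois extension whose Galois group acts trivially on `E(K)/2E(K)`

Topic `NumberTheory/EllipticCurves`. The Galois-module mechanism behind "`2`-descent over all
minimal non-trivial subfields" in the proof of Theorem 2 of T. Dokchitser–V. Dokchitser, *A note on
the Mordell–Weil rank modulo `n`*, J. Number Theory 131 (2011) 1833–1839 (arXiv:0910.4588), in the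
form in which a `2`-descent over a cyclic cubic field `K` is reduced to its *non-trivial isotypic
part*: let `K/F` be a Galois extension of number fields of ODD degree and `E/F` an elliptic curve.

* `Literature.NumberTheory.EllipticCurves.finrank_eq_finrank_of_forall_exists_add_two_smul`
  (algebra): if a finitely generated abelian group `M` satisfies `M = A + 2M` for a subgroup `A`,
  then `rank_ℤ M = rank_ℤ A` (`M/A = 2(M/A)`, so by Nakayama an odd integer kills `M/A`).
* `WeierstrassCurve.mordellWeilRank_baseChange_eq_of_forall_map_sub_mem` : if
  `σ(P) - P ∈ 2E(K)` for all `σ ∈ Gal(K/F)` and `P ∈ E(K)` (i.e. `Gal(K/F)` acts trivially on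
  `E(K)/2E(K)`), then `rank_ℤ E(K) = rank_ℤ E(F)`: the norm `N(P) = ∑_σ σ(P)` lies in `E(F)`
  (Galois descent) and `N(P) ≡ [K:F] P ≡ P (mod 2E(K))`, so `E(K) = E(F) + 2E(K)`.
* `WeierstrassCurve.mordellWeilRank_baseChange_eq_of_forall_isSquare` : the same with the
  hypothesis read through the complete `2`-descent (`TwoDescent.lean`, Silverman AEC Prop. X.1.4,
  `ker δ = 2E(K)`): if `E[2] ⊆ E(F)` with `x`-coordinates `e₁, e₂, e₃ ∈ F` and for every affine
  `P = (x, y) ∈ E(K)` and every `σ` both `σ(x - e₁)·(x - e₁)` and `σ(x - e₂)·(x - e₂)` are squares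
  in `K` — i.e. the `2`-descent image `δ(E(K)) ⊆ (Kˣ/Kˣ²)²` consists of `Gal(K/F)`-INVARIANT square
  classes — then `rank_ℤ E(K) = rank_ℤ E(F)`.

For `Gal(K/F) ≅ C₃` this says: the `2`-descent over `K` need only show that the image of `δ` has
trivial component in the non-trivial `𝔽₂[C₃]`-isotypic part `𝔽₄` of `K(S,2)²`; the trivial part is
the `2`-descent over `F`. Theorems only; no definitions, no named facts.

## Design notes

Theorems only. The two rank theorems are placed in `namespace WeierstrassCurve` as deliberate
dot-notation extensions (`W.mordellWeilRank_baseChange_eq_of_…`, like the tree's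
`WeierstrassCurve.exists_mordellWeilRank_baseChange_eq_add_mul_of_prime`), and the component lemma
next to the tree's `twoDescentComponent` in `WeierstrassCurve.Affine.Point`; the algebra lemma is in
the topic namespace `Literature.NumberTheory.EllipticCurves`. `noncomputable section`,
`open scoped Classical`, fields `F K : Type` as in `CyclicPrimeDegreeRank.lean` / `MordellWeil.lean`
(the group law on points is elaborated against the classical `DecidableEq`). The Galois action is
written `Point.map (σ : K →ₐ[F] K)` (Mathlib), not the `•` of `GaloisAction.lean`, to keep imports
light.

## References

* T. Dokchitser, V. Dokchitser, *A note on the Mordell–Weil rank modulo `n`*, J. Number Theory 131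
  (2011) 1833–1839, arXiv:0910.4588, proof of Thm. 2. [DokchitserDokchitser2011RankModN]
* J. H. Silverman, *The Arithmetic of Elliptic Curves*, 2nd ed., GTM 106 (2009), Prop. X.1.4,
  Thm. VIII.6.7, and Ex. 10.? (Galois action on Selmer groups). [SilvermanAEC2009]
-/

noncomputable section

open scoped Classical

open Module WeierstrassCurve WeierstrassCurve.Affine WeierstrassCurve.Affine.Point

namespace Literature.NumberTheory.EllipticCurves

/-! ### Algebra: `M = A + 2M` forces `rank_ℤ M = rank_ℤ A` -/

/-- **`M = A + 2M ⟹ rank M = rank A`** for a finitely generated abelian group `M` and a subgroup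
`A`: the quotient `Q = M/A` satisfies `Q = 2Q`, so by Nakayama's lemma some `r ≡ 1 (mod 2)` (in
particular `r ≠ 0`) kills `Q`; hence `Q` is a torsion group, of rank `0`, and
`rank M = rank A + rank Q`. [folklore] -/
theorem finrank_eq_finrank_of_forall_exists_add_two_smul {M : Type*} [AddCommGroup M]
    [Module.Finite ℤ M] (A : Submodule ℤ M)
    (h : ∀ m : M, ∃ a ∈ A, ∃ q : M, m = a + (2 : ℤ) • q) :
    Module.finrank ℤ M = Module.finrank ℤ A := by
  haveI : Module.Finite ℤ (M ⧸ A) := Module.Finite.quotient ℤ A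
  set I : Ideal ℤ := Ideal.span {(2 : ℤ)} with hI
  have htop : (⊤ : Submodule ℤ (M ⧸ A)) ≤ I • ⊤ := by
    rintro q -
    induction q using Submodule.Quotient.induction_on with
    | H m =>
      obtain ⟨a, ha, q, rfl⟩ := h m
      rw [Submodule.Quotient.mk_add, (Submodule.Quotient.mk_eq_zero A).mpr ha, zero_add,
        Submodule.Quotient.mk_smul]
      exact Submodule.smul_mem_smul (Ideal.mem_span_singleton_self 2) Submodule.mem_top
  obtain ⟨r, hr1, hr⟩ := Submodule.exists_sub_one_mem_and_smul_eq_zero_of_fg_of_le_smul I ⊤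
    Module.Finite.fg_top htop
  have hr0 : r ≠ 0 := by
    rintro rfl
    rw [zero_sub, hI, Ideal.mem_span_singleton] at hr1
    omega
  have htors : Module.IsTorsion ℤ (M ⧸ A) := fun {q} =>
    ⟨⟨r, mem_nonZeroDivisors_of_ne_zero hr0⟩, hr q Submodule.mem_top⟩
  have hQ : Module.finrank ℤ (M ⧸ A) = 0 := Module.finrank_eq_zero_iff_isTorsion.mpr htors
  -- (`convert` crosses the two (equal) `ℤ`-module structures on `M ⧸ A`)
  have key : Module.finrank ℤ (M ⧸ A) + Module.finrank ℤ A = Module.finrank ℤ M := by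
    convert A.finrank_quotient_add_finrank <;> rfl
  omega

end Literature.NumberTheory.EllipticCurves

namespace WeierstrassCurve.Affine.Point

/-- The `2`-descent component at `T = (a, *)` is unchanged under `σ ∈ Aut(K/F)` fixing
`a, b, c` when `σ(x - a)(x - a)` is a square: at `x = a` both values are `(a - b)(a - c)`, otherwise
`[σ(x) - a] = [x - a]` in `Kˣ/Kˣ²`. [cite: SilvermanAEC2009, Prop. X.1.4] -/
theorem twoDescentComponent_some_map_eq {F K : Type*} [Field F] [Field K] [Algebra F K]
    {V : Affine K} (σ : K ≃ₐ[F] K)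
    {a b c x y : K} (ha : σ a = a) (hP : V.Nonsingular x y) (hσP : V.Nonsingular (σ x) (σ y))
    (hsq : IsSquare (σ (x - a) * (x - a))) :
    twoDescentComponent V a b c (Point.some (σ x) (σ y) hσP) =
      twoDescentComponent V a b c (Point.some x y hP) := by
  have hσxa : σ x - a = σ (x - a) := by rw [map_sub, ha]
  by_cases hx : x = a
  · have hσx : σ x = a := by rw [hx, ha]
    rw [twoDescentComponent_some_of_eq hσP hσx,
      twoDescentComponent_some_of_eq hP hx]
  · have hxa : x - a ≠ 0 := sub_ne_zero.mpr hx
    have hσxa0 : σ (x - a) ≠ 0 := (map_ne_zero σ).mpr hxa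
    have hσx : σ x ≠ a := fun H => hσxa0 (by rw [← hσxa, H, sub_self])
    rw [twoDescentComponent_some_of_ne hσP hσx,
      twoDescentComponent_some_of_ne hP hx, hσxa]
    obtain ⟨z, hz⟩ := hsq
    have h1 : sqClass (σ (x - a)) * sqClass (x - a) = 1 := by
      rw [← sqClass_mul hσxa0 hxa, hz, sqClass_mul_self]
    rw [SqUnits.eq_mul_of_mul_eq h1, SqUnits.one_mul]

end WeierstrassCurve.Affine.Point

namespace WeierstrassCurve

open Literature.NumberTheory.EllipticCurves

variable {F : Type} [Field F] [NumberField F] (W : WeierstrassCurve F) [W.IsElliptic]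
  (K : Type) [Field K] [NumberField K] [Algebra F K] [IsGalois F K]

/-- **Trivial Galois action on `E(K)/2E(K)` in odd degree forces `rank E(K) = rank E(F)`.**
Let `K/F` be a Galois extension of number fields of odd degree and `E/F` an elliptic curve (model
`W`); `Gal(K/F)` acts on `E(K)` by transport of coordinates (Mathlib `Point.map`). If
`σ(P) - P ∈ 2E(K)` for every `σ ∈ Gal(K/F)` and `P ∈ E(K)`, then `rank_ℤ E(K) = rank_ℤ E(F)`.
Proof: `N(P) = ∑_σ σ(P)` is `Gal(K/F)`-fixed, hence in (the image of) `E(F)` (Galois descent,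
Mathlib `IsGalois.mem_range_algebraMap_iff_fixed`), and
`N(P) - [K:F]·P = ∑_σ (σ(P) - P) ∈ 2E(K)`; as `[K:F]` is odd, `P ∈ E(F) + 2E(K)`. So
`E(K) = E(F) + 2E(K)` and `finrank_eq_finrank_of_forall_exists_add_two_smul` applies (`E(K)`
is finitely generated: Mordell–Weil, tree theorem `module_finite_point_holds`). [folklore] -/
theorem mordellWeilRank_baseChange_eq_of_forall_map_sub_mem (hodd : Odd (Module.finrank F K))
    (h : ∀ (σ : K ≃ₐ[F] K) (P : (W.baseChange K).toAffine.Point),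
      Point.map (W' := W.toAffine) (σ : K →ₐ[F] K) P - P ∈
        (nsmulAddMonoidHom 2 : (W.baseChange K).toAffine.Point →+ _).range) :
    (W.baseChange K).mordellWeilRank = (W.baseChange F).mordellWeilRank := by
  haveI : (W.baseChange K).IsElliptic := inferInstanceAs (W.map (algebraMap F K)).IsElliptic
  haveI : (W.baseChange F).IsElliptic := inferInstanceAs (W.map (algebraMap F F)).IsElliptic
  haveI : Module.Finite ℤ (W.baseChange K).toAffine.Point :=
    (W.baseChange K).module_finite_point_holds
  haveI : Module.Finite ℤ (W.baseChange F).toAffine.Point :=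
    (W.baseChange F).module_finite_point_holds
  -- the image `A` of `E(F)` in `E(K)`
  set ι : (W.baseChange F).toAffine.Point →ₗ[ℤ] (W.baseChange K).toAffine.Point :=
    (Point.baseChange (W' := W.toAffine) F K).toIntLinearMap with hι
  have hιinj : Function.Injective ι := Point.map_injective (W' := W.toAffine) (Algebra.ofId F K)
  set A : Submodule ℤ (W.baseChange K).toAffine.Point := LinearMap.range ι with hAdef
  -- Galois descent: fixed points lie in `A`
  have hA' : ∀ m : (W.baseChange K).toAffine.Point,
      (∀ σ : K ≃ₐ[F] K, Point.map (W' := W.toAffine) (σ : K →ₐ[F] K) m = m) →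
        m ∈ A := by
    intro m hm
    rcases m with _ | ⟨x, y, hxy⟩
    · exact ⟨0, rfl⟩
    · have hfix : ∀ z : K, (∀ σ : K ≃ₐ[F] K, σ z = z) →
          z ∈ Set.range (algebraMap F K) :=
        fun z hz => (IsGalois.mem_range_algebraMap_iff_fixed z).mpr hz
      have hx : ∀ σ : K ≃ₐ[F] K, σ x = x := fun σ => by
        have e := hm σ
        rw [Point.map_some] at e
        exact (Point.some.inj e).1
      have hy : ∀ σ : K ≃ₐ[F] K, σ y = y := fun σ => by
        have e := hm σ
        rw [Point.map_some] at e
        exact (Point.some.inj e).2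
      obtain ⟨x₀, rfl⟩ := hfix x hx
      obtain ⟨y₀, rfl⟩ := hfix y hy
      have h₀ : (W.baseChange F).toAffine.Nonsingular x₀ y₀ :=
        (baseChange_nonsingular (W := W.toAffine) (f := Algebra.ofId F K)
          (Algebra.ofId F K).injective x₀ y₀).mp hxy
      exact ⟨Point.some x₀ y₀ h₀, rfl⟩
  -- the norm `N(P) = ∑_σ σ(P)` is fixed
  have hN : ∀ P : (W.baseChange K).toAffine.Point,
      (∑ σ : K ≃ₐ[F] K, Point.map (W' := W.toAffine) (σ : K →ₐ[F] K) P) ∈ A := by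
    intro P
    refine hA' _ fun τ => ?_
    rw [map_sum]
    simp_rw [Point.map_map]
    exact Fintype.sum_equiv (Equiv.mulLeft τ) _ _ fun σ => rfl
  -- `E(K) = A + 2E(K)`
  have key : ∀ m : (W.baseChange K).toAffine.Point,
      ∃ a ∈ A, ∃ q, m = a + (2 : ℤ) • q := by
    intro P
    -- `∑_σ (σ P - P) = 2 • Q`
    have hsum : ∃ Q : (W.baseChange K).toAffine.Point,
        (∑ σ : K ≃ₐ[F] K, (Point.map (W' := W.toAffine) (σ : K →ₐ[F] K) P - P)) =
          2 • Q := by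
      have hmem :
          (∑ σ : K ≃ₐ[F] K, (Point.map (W' := W.toAffine) (σ : K →ₐ[F] K) P - P)) ∈
          (nsmulAddMonoidHom 2 : (W.baseChange K).toAffine.Point →+ _).range :=
        AddSubgroup.sum_mem _ fun σ _ => h σ P
      obtain ⟨Q, hQ⟩ := hmem
      exact ⟨Q, by rw [← hQ, nsmulAddMonoidHom_apply]⟩
    obtain ⟨Q, hQ⟩ := hsum
    rw [Finset.sum_sub_distrib, Finset.sum_const, Finset.card_univ, sub_eq_iff_eq_add] at hQ
    -- `#Gal = [K:F]` is odd
    have hcard : Fintype.card (K ≃ₐ[F] K) = Module.finrank F K := by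
      rw [← Nat.card_eq_fintype_card, IsGalois.card_aut_eq_finrank]
    obtain ⟨k, hk⟩ := hodd
    refine ⟨∑ σ : K ≃ₐ[F] K, Point.map (W' := W.toAffine) (σ : K →ₐ[F] K) P, hN P,
      -(Q + k • P), ?_⟩
    rw [hQ, hcard, hk, smul_neg, smul_add, add_smul, mul_smul, one_smul, two_smul, ofNat_zsmul,
      two_smul]
    abel
  have hrank := finrank_eq_finrank_of_forall_exists_add_two_smul A key
  have hAF : Module.finrank ℤ A = Module.finrank ℤ (W.baseChange F).toAffine.Point :=
    (LinearEquiv.ofInjective ι hιinj).finrank_eq.symm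
  unfold mordellWeilRank
  rw [hrank, hAF]

/-- **Galois-invariant `2`-descent image in odd degree forces `rank E(K) = rank E(F)`.** Let
`K/F` be Galois of odd degree, `E/F` an elliptic curve whose `2`-torsion is `F`-rational with
`x`-coordinates `e₁, e₂, e₃` (`SplitTwoTorsion` of the base change to `K` at
`e₁, e₂, e₃ ∈ F`). If for every affine point `(x, y) ∈ E(K)` and every `σ ∈ Gal(K/F)` the
elements `σ(x - e₁)(x - e₁)` and `σ(x - e₂)(x - e₂)` are squares in `K` — equivalently, the
complete `2`-descent map `δ = (x - e₁, x - e₂) : E(K) → (Kˣ/Kˣ²)²` (Silverman AEC Prop. X.1.4)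
satisfies `δ(σP) = δ(P)`, i.e. `δ(E(K))` consists of `Gal(K/F)`-invariant square classes — then
`σ(P) - P ∈ ker δ = 2E(K)` (`ker_twoDescentMap`) and
`mordellWeilRank_baseChange_eq_of_forall_map_sub_mem` gives `rank_ℤ E(K) = rank_ℤ E(F)`. (At a
`2`-torsion point `x = eᵢ` the hypothesis holds trivially, `σ(x - eᵢ)(x - eᵢ) = 0 = 0²`.)
[cite: SilvermanAEC2009, Prop. X.1.4] -/
theorem mordellWeilRank_baseChange_eq_of_forall_isSquare (hodd : Odd (Module.finrank F K))
    {e₁ e₂ e₃ : F}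
    (he : (W.baseChange K).toAffine.SplitTwoTorsion (algebraMap F K e₁) (algebraMap F K e₂)
      (algebraMap F K e₃))
    (h : ∀ (σ : K ≃ₐ[F] K) (x y : K), (W.baseChange K).toAffine.Nonsingular x y →
      IsSquare (σ (x - algebraMap F K e₁) * (x - algebraMap F K e₁)) ∧
        IsSquare (σ (x - algebraMap F K e₂) * (x - algebraMap F K e₂))) :
    (W.baseChange K).mordellWeilRank = (W.baseChange F).mordellWeilRank := by
  haveI : (W.baseChange K).IsElliptic := inferInstanceAs (W.map (algebraMap F K)).IsElliptic
  refine W.mordellWeilRank_baseChange_eq_of_forall_map_sub_mem K hodd fun σ P => ?_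
  rw [← ker_twoDescentMap he, AddMonoidHom.mem_ker, map_sub]
  suffices hfix : twoDescentMap he (Point.map (W' := W.toAffine) (σ : K →ₐ[F] K) P) =
      twoDescentMap he P by
    rw [hfix]; exact sub_self (twoDescentMap he P)
  rcases P with _ | ⟨x, y, hxy⟩
  · rfl
  · rw [Point.map_some]
    have hσP : (W.baseChange K).toAffine.Nonsingular (σ x) (σ y) :=
      (baseChange_nonsingular (W := W.toAffine) (f := (σ : K →ₐ[F] K)) σ.injective x y).mpr
        hxy
    obtain ⟨h₁, h₂⟩ := h σ x y hxy
    have c₁ := twoDescentComponent_some_map_eq (F := F) σ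
      (b := algebraMap F K e₂) (c := algebraMap F K e₃) (σ.commutes e₁) hxy hσP h₁
    have c₂ := twoDescentComponent_some_map_eq (F := F) σ
      (b := algebraMap F K e₁) (c := algebraMap F K e₃) (σ.commutes e₂) hxy hσP h₂
    rw [twoDescentMap_apply, twoDescentMap_apply]
    change Additive.ofMul (twoDescentComponent _ _ _ _ (Point.some (σ x) (σ y) _),
      twoDescentComponent _ _ _ _ (Point.some (σ x) (σ y) _)) = _
    rw [c₁, c₂]

end WeierstrassCurve

end
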